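import Literature.Analysis.FluidPDE.PeriodicLerayGalerkinCompactness
import Literature.Analysis.FluidPDE.PeriodicLerayLimitVelocity
import Literature.Analysis.FluidPDE.CaloricLocalLerayLp
import HarnessLib

/-!
# [BT1] proof of Theorem 2.4 — the Galerkin limit `k → ∞`: one subsequence, one limit field

Analysis/FluidPDE proof file (theorems only; no definitions, no named facts) in the DAG below the
named fact `Literature.Analysis.FluidPDE.bradshawTsai2017_thm_2_4_mollified`
(`PeriodicLerayExistence.lean`; Bradshaw–Tsai, Ann. Henri Poincaré 18 (2017) = arXiv:1510.07504
[BT1], proof of Thm 2.4, limit `k → ∞` of the Galerkin approximants of Lemma 2.6).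

`exists_galerkin_velocity_limit`: the diagonal procedure over the cylinders
`Q_n = (−n−1, n+1) × B(0, n+1)` (exactly as in `PeriodicLerayLimitVelocity.exists_velocity_limit`
for the limit `ε → 0`, whose gluing lemmas are reused) applied to the cylinder compactness of
the Galerkin approximants (`PeriodicLerayGalerkinCompactness.exists_subseq_strong_limit_galerkin`):
along one subsequence the approximants `U_k(s) = Σᵢ b_{ki}(s) a_{ki}` converge strongly in
`L²(Q_n)` for every `n`, and slice-wise in `𝒟'(B(0,n+1))` for a.e. `t`, to one jointly
measurable field `u` on `ℝ × ℝ³` with `∫_{B(0,n+1)} |u(t)|² ≤ C_b` for a.e. `t ∈ (−n−1, n+1)`.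

## References

* Z. Bradshaw, T.-P. Tsai, Ann. Henri Poincaré 18 (2017) = arXiv:1510.07504, proof of Thm 2.4
  [BradshawTsai2017AHP].
* G. Seregin, *Lecture notes on regularity theory for the Navier–Stokes equations* (2014),
  App. B §B.4 (diagonal extraction) [Seregin2015].
-/

noncomputable section

open MeasureTheory Set Function Filter Topology TopologicalSpace Metric
open Literature.Analysis.FunctionSpaces
open scoped NNReal ENNReal InnerProductSpace RealInnerProductSpace

namespace Literature.Analysis.FluidPDE

namespace BradshawTsai2017

section GalerkinSequence

variable {k : ℕ} {a : Fin k → EuclideanSpace ℝ (Fin 3) → EuclideanSpace ℝ (Fin 3)} {b : ℝ → EuclideanSpace ℝ (Fin k)}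

/-- Joint continuity of `(t, y) ↦ Σᵢ bᵢ(t) aᵢ(y)`. [folklore] -/
theorem continuous_uncurry_galerkinSum
    (ha : ∀ i, IsTestFunctionOn (⊤ : Opens (EuclideanSpace ℝ (Fin 3))) (a i)) (hb : Continuous b) :
    Continuous (uncurry fun t y => galerkinSum a (b t) y) := by
  have e : (uncurry fun t y => galerkinSum a (b t) y) = fun z : ℝ × EuclideanSpace ℝ (Fin 3) => ∑ i, b z.1 i • a i z.2 := by
    funext z; simp only [uncurry, galerkinSum_apply]
  rw [e]
  refine continuous_finsetSum _ fun i _ => ?_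
  exact ((PiLp.continuous_apply 2 _ i).comp (hb.comp continuous_fst)).smul
    ((ha i).contDiff.continuous.comp continuous_snd)

/-- Joint continuity of `(t, y) ↦ D(Σᵢ bᵢ(t) aᵢ)(y)`. [folklore] -/
theorem continuous_uncurry_fderiv_galerkinSum
    (ha : ∀ i, IsTestFunctionOn (⊤ : Opens (EuclideanSpace ℝ (Fin 3))) (a i)) (hb : Continuous b) :
    Continuous (uncurry fun t y => fderiv ℝ (galerkinSum a (b t)) y) := by
  have ha1 : ∀ i, ContDiff ℝ 1 (a i) := fun i => (ha i).contDiff.of_le (by exact_mod_cast le_top)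
  have had : ∀ i, Differentiable ℝ (a i) := fun i => (ha1 i).differentiable one_ne_zero
  have e : (uncurry fun t y => fderiv ℝ (galerkinSum a (b t)) y) =
      fun z : ℝ × EuclideanSpace ℝ (Fin 3) => ∑ i, b z.1 i • fderiv ℝ (a i) z.2 := by
    funext z
    simp only [uncurry]
    exact fderiv_galerkinSum had _ _
  rw [e]
  refine continuous_finsetSum _ fun i _ => ?_
  exact ((PiLp.continuous_apply 2 _ i).comp (hb.comp continuous_fst)).smul
    (((ha1 i).continuous_fderiv one_ne_zero).comp continuous_snd)

/-- The classical spatial derivative of `(t, y) ↦ Σᵢ bᵢ(t) aᵢ(y)` is a weak spatial gradient on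
`ℝ × ℝ³`. [folklore] -/
theorem hasWeakSpatialGradientOn_galerkinSum
    (ha : ∀ i, IsTestFunctionOn (⊤ : Opens (EuclideanSpace ℝ (Fin 3))) (a i)) (hb : Continuous b) :
    HasWeakSpatialGradientOn (⊤ : Opens (ℝ × EuclideanSpace ℝ (Fin 3))) (fun t y => galerkinSum a (b t) y)
      (fun t y => fderiv ℝ (galerkinSum a (b t)) y) := by
  have ha1 : ∀ i, ContDiff ℝ 1 (a i) := fun i => (ha i).contDiff.of_le (by exact_mod_cast le_top)
  have had : ∀ i, Differentiable ℝ (a i) := fun i => (ha1 i).differentiable one_ne_zero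
  refine hasWeakSpatialGradientOn_of_hasFDerivAt (S := univ) (fun _ _ => by simp)
    (continuous_uncurry_galerkinSum ha hb).continuousOn
    (continuous_uncurry_fderiv_galerkinSum ha hb).continuousOn fun t _ x => ?_
  have h := hasFDerivAt_galerkinSum had (b t) x
  rw [(hasFDerivAt_galerkinSum had (b t) x).fderiv]
  exact h

/-- The energy of the approximants, as a Lebesgue integral: `∫ ‖Σ bᵢaᵢ‖ₑ² ≤ ofReal C_b`.
[folklore] -/
theorem lintegral_enorm_sq_galerkinSum_le
    (ha : ∀ i, IsTestFunctionOn (⊤ : Opens (EuclideanSpace ℝ (Fin 3))) (a i))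
    (hon : ∀ i j, ∫ y, ⟪a i y, a j y⟫ = if i = j then (1 : ℝ) else 0)
    {Cb : ℝ} {c : EuclideanSpace ℝ (Fin k)} (hc : ‖c‖ ^ 2 ≤ Cb) :
    ∫⁻ y, ‖galerkinSum a c y‖ₑ ^ 2 ≤ ENNReal.ofReal Cb := by
  have ht := isTestFunctionOn_galerkinSum ha c
  rw [lintegral_enorm_sq_eq_ofReal_of_continuous ht.contDiff.continuous ht.hasCompactSupport,
    integral_norm_sq_galerkinSum (fun i => (ha i).contDiff.continuous)
      (fun i => (ha i).hasCompactSupport) hon c]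
  exact ENNReal.ofReal_le_ofReal hc

/-- The dissipation of the approximants over a period, as a space–time Lebesgue integral:
`∫∫_{(0,T)×ℝ³} |D U_k|²_F ≤ ofReal C_d`. [folklore] -/
theorem lintegral_period_frobenius_galerkinSum_le {T : ℝ} (hT : 0 < T)
    (ha : ∀ i, IsTestFunctionOn (⊤ : Opens (EuclideanSpace ℝ (Fin 3))) (a i)) (hb : Continuous b) {Cd : ℝ}
    (hCd : ∫ s in (0 : ℝ)..T, (∫ y, frobeniusNormSq (fderiv ℝ (galerkinSum a (b s)) y)) ≤ Cd) :
    ∫⁻ z in Ioo 0 T ×ˢ (univ : Set (EuclideanSpace ℝ (Fin 3))),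
      ENNReal.ofReal (frobeniusNormSq (fderiv ℝ (galerkinSum a (b z.1)) z.2)) ≤ ENNReal.ofReal Cd := by
  have hmeas : AEMeasurable (fun z : ℝ × EuclideanSpace ℝ (Fin 3) =>
      ENNReal.ofReal (frobeniusNormSq (fderiv ℝ (galerkinSum a (b z.1)) z.2)))
      (((volume : Measure ℝ).restrict (Ioo 0 T)).prod (volume : Measure (EuclideanSpace ℝ (Fin 3)))) :=
    (ENNReal.continuous_ofReal.comp (continuous_frobeniusNormSq_comp
      (continuous_uncurry_fderiv_galerkinSum ha hb))).measurable.aemeasurable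
  rw [volume_restrict_prod_univ, lintegral_prod _ hmeas]
  have hin : ∀ t, ∫⁻ y, ENNReal.ofReal (frobeniusNormSq (fderiv ℝ (galerkinSum a (b t)) y)) =
      ENNReal.ofReal (∫ y, frobeniusNormSq (fderiv ℝ (galerkinSum a (b t)) y)) := fun t =>
    (ofReal_integral_eq_lintegral_ofReal (integrable_frobeniusNormSq_fderiv (isTestFunctionOn_galerkinSum ha (b t)))
      (ae_of_all _ fun _ => frobeniusNormSq_nonneg _)).symm
  simp_rw [hin]
  set D : ℝ → ℝ := fun t => ∫ y, frobeniusNormSq (fderiv ℝ (galerkinSum a (b t)) y) with hD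
  have hDc : Continuous D := continuous_dissipation_galerkinSum ha hb
  have hD0 : ∀ t, 0 ≤ D t := fun t => integral_nonneg fun _ => frobeniusNormSq_nonneg _
  have hDi : IntegrableOn D (Ioo 0 T) volume := (hDc.integrableOn_Icc).mono_set Ioo_subset_Icc_self
  rw [← ofReal_integral_eq_lintegral_ofReal hDi (ae_of_all _ fun t => hD0 t)]
  refine ENNReal.ofReal_le_ofReal ?_
  have e : ∫ t in Ioo 0 T, D t = ∫ t in (0 : ℝ)..T, D t := by
    rw [intervalIntegral.integral_of_le hT.le, integral_Ioc_eq_integral_Ioo]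
  rw [e]
  exact hCd

end GalerkinSequence

section GalerkinLimit

variable {T : ℝ} {W : ℝ → EuclideanSpace ℝ (Fin 3) → EuclideanSpace ℝ (Fin 3)}
  {ρ : EuclideanSpace ℝ (Fin 3) → ℝ}

set_option maxHeartbeats 800000 in
/-- **The Galerkin limit `k → ∞`: one subsequence, one limit on `ℝ × ℝ³`** ([BT1], proof of
Thm 2.4; diagonal procedure of Seregin 2014, App. B §B.4). See the module docstring.
[cite: BradshawTsai2017AHP, proof of Thm 2.4 (limit k → ∞)] -/
theorem exists_galerkin_velocity_limit (hT : 0 < T) (hW : ContDiff ℝ 1 (uncurry W))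
    (hWper : ∀ s y, W (s + T) y = W s y)
    (hℓ : ∀ g : EuclideanSpace ℝ (Fin 3) → EuclideanSpace ℝ (Fin 3),
      IsTestFunctionOn (⊤ : Opens (EuclideanSpace ℝ (Fin 3))) g → ∃ Cℓ : ℝ, ∀ s, |lerayPairing W s g| ≤ Cℓ)
    (hρ : Continuous ρ) (hρc : HasCompactSupport ρ)
    {σ : ℕ → EuclideanSpace ℝ (Fin 3) → EuclideanSpace ℝ (Fin 3)}
    (hσ : ∀ n, σ n ∈ testDivFreeSubmodule)
    (hσd : ∀ (N : ℕ) (ζ : EuclideanSpace ℝ (Fin 3) → EuclideanSpace ℝ (Fin 3)),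
      ζ ∈ testDivFreeSubmodule → tsupport ζ ⊆ closedBall (0 : EuclideanSpace ℝ (Fin 3)) N →
        ∀ δ : ℝ, 0 < δ → ∃ n, tsupport (σ n) ⊆ closedBall (0 : EuclideanSpace ℝ (Fin 3)) N ∧
          ∀ y, ‖ζ y - σ n y‖ ≤ δ ∧ ‖fderiv ℝ ζ y - fderiv ℝ (σ n) y‖ ≤ δ)
    {kk : ℕ → ℕ} {a : ∀ m, Fin (kk m) → EuclideanSpace ℝ (Fin 3) → EuclideanSpace ℝ (Fin 3)}
    {b : ∀ m, ℝ → EuclideanSpace ℝ (Fin (kk m))}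
    (haV : ∀ m i, a m i ∈ testDivFreeSubmodule)
    (hon : ∀ m i j, ∫ y, ⟪a m i y, a m j y⟫ = if i = j then (1 : ℝ) else 0)
    (hgal : ∀ m, ∀ g ∈ galerkinSpace σ m, ∃ c : EuclideanSpace ℝ (Fin (kk m)), galerkinSum (a m) c = g)
    (hb : ∀ m s, HasDerivAt (b m) (galerkinRHS W ρ (a m) s (b m s)) s)
    (hbT : ∀ m s, b m (s + T) = b m s)
    {Cb Cd : ℝ} (hCb0 : 0 ≤ Cb) (hCd0 : 0 ≤ Cd) (hCb : ∀ m s, ‖b m s‖ ^ 2 ≤ Cb)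
    (hCd : ∀ m, ∫ s in (0 : ℝ)..T, (∫ y, frobeniusNormSq (fderiv ℝ (galerkinSum (a m) (b m s)) y)) ≤ Cd) :
    ∃ (φ : ℕ → ℕ) (u : ℝ → EuclideanSpace ℝ (Fin 3) → EuclideanSpace ℝ (Fin 3)), StrictMono φ ∧
      (∀ k, φ k ≤ φ (k + 1) ∧ k ≤ φ k) ∧
      AEStronglyMeasurable (uncurry u) (volume : Measure (ℝ × EuclideanSpace ℝ (Fin 3))) ∧
      (∀ n : ℕ, ∀ᵐ t ∂(volume.restrict (Ioo (-((n : ℝ) + 1)) ((n : ℝ) + 1))),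
        ∫⁻ x in ball (0 : EuclideanSpace ℝ (Fin 3)) (n + 1), ‖u t x‖ₑ ^ 2 ≤ ENNReal.ofReal Cb) ∧
      (∀ n : ℕ, Tendsto (fun k => ∫⁻ z in Ioo (-((n : ℝ) + 1)) ((n : ℝ) + 1) ×ˢ
          ball (0 : EuclideanSpace ℝ (Fin 3)) (n + 1),
          ‖galerkinSum (a (φ k)) (b (φ k) z.1) z.2 - u z.1 z.2‖ₑ ^ 2) atTop (𝓝 0)) ∧
      (∀ n : ℕ, ∀ θ : EuclideanSpace ℝ (Fin 3) → ℝ,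
        IsTestFunctionOn
          (⟨ball (0 : EuclideanSpace ℝ (Fin 3)) (n + 1), isOpen_ball⟩ : Opens (EuclideanSpace ℝ (Fin 3))) θ →
        ∀ᵐ t ∂(volume.restrict (Ioo (-((n : ℝ) + 1)) ((n : ℝ) + 1))),
          Tendsto (fun k => ∫ x in ball (0 : EuclideanSpace ℝ (Fin 3)) (n + 1),
            θ x • galerkinSum (a (φ k)) (b (φ k) t) x)
            atTop (𝓝 (∫ x in ball (0 : EuclideanSpace ℝ (Fin 3)) (n + 1), θ x • u t x))) := by
  -- the approximants as one sequence of fields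
  set U : ℕ → ℝ → EuclideanSpace ℝ (Fin 3) → EuclideanSpace ℝ (Fin 3) :=
    fun k t y => galerkinSum (a k) (b k t) y with hUdef
  have ha : ∀ m i, IsTestFunctionOn (⊤ : Opens (EuclideanSpace ℝ (Fin 3))) (a m i) :=
    fun m i => (mem_testDivFreeSubmodule.1 (haV m i)).1
  have hbc : ∀ m, Continuous (b m) := fun m =>
    continuous_iff_continuousAt.2 fun s => (hb m s).continuousAt
  have hUj : ∀ k, Continuous (uncurry (U k)) := fun k => by
    have e : uncurry (U k) = fun z : ℝ × EuclideanSpace ℝ (Fin 3) => ∑ i, b k z.1 i • a k i z.2 := by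
      funext z; simp only [uncurry, hUdef, galerkinSum_apply]
    rw [e]
    refine continuous_finsetSum _ fun i _ => ?_
    exact ((PiLp.continuous_apply 2 _ i).comp ((hbc k).comp continuous_fst)).smul
      ((ha k i).contDiff.continuous.comp continuous_snd)
  -- the cylinders `Q n = (−n−1, n+1) × B(0, n + 1)`
  set I : ℕ → Set ℝ := fun n => Ioo (-((n : ℝ) + 1)) ((n : ℝ) + 1) with hI
  set Ω : ℕ → Opens (EuclideanSpace ℝ (Fin 3)) := fun n =>
    ⟨ball (0 : EuclideanSpace ℝ (Fin 3)) (n + 1), isOpen_ball⟩ with hΩ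
  set Q : ℕ → Set (ℝ × EuclideanSpace ℝ (Fin 3)) := fun n =>
    Ioo (-((n : ℝ) + 1)) ((n : ℝ) + 1) ×ˢ ball (0 : EuclideanSpace ℝ (Fin 3)) (n + 1) with hQ
  have hQm : ∀ n, MeasurableSet (Q n) := fun n => measurableSet_Ioo.prod measurableSet_ball
  have hQmono : ∀ {n m : ℕ}, n ≤ m → Q n ⊆ Q m := fun {n m} h => by
    have : (n : ℝ) ≤ m := Nat.cast_le.2 h
    exact Set.prod_mono (Ioo_subset_Ioo (by linarith) (by linarith)) (ball_subset_ball (by linarith))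
  have hvm : ∀ k n, AEStronglyMeasurable (uncurry (U k)) (volume.restrict (Q n)) := fun k n =>
    (hUj k).aestronglyMeasurable.restrict
  -- the extraction property on `Q n`
  let P : ℕ → (ℕ → ℕ) → Prop := fun n φ =>
    ∃ w : ℝ → EuclideanSpace ℝ (Fin 3) → EuclideanSpace ℝ (Fin 3),
      AEStronglyMeasurable (uncurry w) (volume.restrict (Q n)) ∧
      (∀ᵐ t ∂(volume.restrict (I n)),
        ∫⁻ x in ball (0 : EuclideanSpace ℝ (Fin 3)) (n + 1), ‖w t x‖ₑ ^ 2 ≤ ENNReal.ofReal Cb) ∧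
      Tendsto (fun k => ∫⁻ z in Q n, ‖U (φ k) z.1 z.2 - w z.1 z.2‖ₑ ^ 2) atTop (𝓝 0) ∧
      ∀ θ : EuclideanSpace ℝ (Fin 3) → ℝ, IsTestFunctionOn (Ω n) θ →
        ∀ᵐ t ∂(volume.restrict (I n)),
          Tendsto (fun k => ∫ x in ball (0 : EuclideanSpace ℝ (Fin 3)) (n + 1), θ x • U (φ k) t x)
            atTop (𝓝 (∫ x in ball (0 : EuclideanSpace ℝ (Fin 3)) (n + 1), θ x • w t x))
  have hsub : ∀ n (φ φ' : ℕ → ℕ), (∃ ρ : ℕ → ℕ, StrictMono ρ ∧ ∀ᶠ k in atTop, φ' k = φ (ρ k)) →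
      P n φ → P n φ' := by
    rintro n φ φ' ⟨ρ', hρ', heq⟩ ⟨w, hwm, hwb, hwt, hwP⟩
    refine ⟨w, hwm, hwb, tendsto_of_eventually_eq_comp
      (a := fun j => ∫⁻ z in Q n, ‖U j z.1 z.2 - w z.1 z.2‖ₑ ^ 2) hρ' heq hwt, fun θ hθ => ?_⟩
    filter_upwards [hwP θ hθ] with t ht
    exact tendsto_of_eventually_eq_comp
      (a := fun j => ∫ x in ball (0 : EuclideanSpace ℝ (Fin 3)) (n + 1), θ x • U j t x) hρ' heq ht
  have hex : ∀ n (φ : ℕ → ℕ), StrictMono φ → ∃ ψ : ℕ → ℕ, StrictMono ψ ∧ P n (φ ∘ ψ) := by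
    intro n φ hφ
    obtain ⟨σ', w, hσ', hwm, hwb, hwt, hwP⟩ :=
      exists_subseq_strong_limit_galerkin (kk := fun k => kk (φ k)) (a := fun k => a (φ k))
        (b := fun k => b (φ k)) hT hW hWper hℓ hρ hρc hσ hσd
        (fun k i => haV (φ k) i) (fun k => hon (φ k))
        (fun k g hg => hgal (φ k) g (galerkinSpace_mono σ (hφ.id_le k) hg))
        (fun k => hb (φ k)) (fun k => hbT (φ k)) hCb0 hCd0 (fun k => hCb (φ k)) (fun k => hCd (φ k))
        (-((n : ℝ) + 1)) ((n : ℝ) + 1) (0 : EuclideanSpace ℝ (Fin 3)) ((n : ℝ) + 1)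
    exact ⟨σ', hσ', w, hwm, hwb, hwt, hwP⟩
  obtain ⟨φ, hφ, hP⟩ := exists_strictMono_forall_of_extraction hsub hex
  choose w hwm hwb hwt hwP using hP
  -- the limits agree on the smaller cylinder
  have hcons : ∀ n m, n ≤ m → ∀ᵐ z ∂(volume.restrict (Q n)), uncurry (w n) z = uncurry (w m) z := by
    intro n m hnm
    have hwt' : Tendsto (fun k => ∫⁻ z in Q n, ‖U (φ k) z.1 z.2 - w m z.1 z.2‖ₑ ^ 2) atTop (𝓝 0) :=
      tendsto_of_tendsto_of_tendsto_of_le_of_le tendsto_const_nhds (hwt m) (fun _ => bot_le)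
        fun _ => lintegral_mono_set (hQmono hnm)
    exact Seregin2014Limit.ae_eq_of_tendsto_lintegral_sub_sq (f := fun k => uncurry (U (φ k)))
      (fun k => hvm (φ k) n) (hwm n)
      ((hwm m).mono_measure (Measure.restrict_mono (hQmono hnm) le_rfl)) (hwt n) hwt'
  -- glue along the exhaustion, indexed by `N z = max ⌊|z.1|⌋₊ ⌊‖z.2‖⌋₊`
  set N : ℝ × EuclideanSpace ℝ (Fin 3) → ℕ := fun z => max ⌊|z.1|⌋₊ ⌊‖z.2‖⌋₊ with hN
  have hmemQ : ∀ z : ℝ × EuclideanSpace ℝ (Fin 3), z ∈ Q (N z) := by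
    intro z
    have h1 : |z.1| < ⌊|z.1|⌋₊ + 1 := Nat.lt_floor_add_one _
    have h2 : ‖z.2‖ < ⌊‖z.2‖⌋₊ + 1 := Nat.lt_floor_add_one _
    have h3 : (⌊|z.1|⌋₊ : ℝ) ≤ N z := Nat.cast_le.2 (le_max_left _ _)
    have h4 : (⌊‖z.2‖⌋₊ : ℝ) ≤ N z := Nat.cast_le.2 (le_max_right _ _)
    refine ⟨⟨?_, ?_⟩, ?_⟩
    · linarith [neg_abs_le z.1]
    · linarith [le_abs_self z.1]
    · rw [mem_ball_zero_iff]; linarith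
  have hNS : ∀ z ∈ ⋃ n, Q n, z ∈ Q (N z) := fun z _ => hmemQ z
  have hNle : ∀ n, ∀ z ∈ Q n, N z ≤ n := by
    intro n z hz
    have h1 : |z.1| < n + 1 := abs_lt.2 ⟨hz.1.1, hz.1.2⟩
    have h2 : ‖z.2‖ < n + 1 := by
      have := hz.2
      rwa [mem_ball_zero_iff] at this
    have h3 : ⌊|z.1|⌋₊ < n + 1 := (Nat.floor_lt (abs_nonneg _)).2 (by exact_mod_cast h1)
    have h4 : ⌊‖z.2‖⌋₊ < n + 1 := (Nat.floor_lt (norm_nonneg _)).2 (by exact_mod_cast h2)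
    exact max_le (by omega) (by omega)
  obtain ⟨Ug, hU, hUm⟩ := exists_glue_of_ae_eq
    (μ := (volume : Measure (ℝ × EuclideanSpace ℝ (Fin 3)))) hQm N hNS hNle (fun n => uncurry (w n)) hcons
  have hUnion : (⋃ n, Q n) = (univ : Set (ℝ × EuclideanSpace ℝ (Fin 3))) :=
    eq_univ_of_forall fun z => mem_iUnion.2 ⟨N z, hmemQ z⟩
  have hUmeas : AEStronglyMeasurable Ug (volume : Measure (ℝ × EuclideanSpace ℝ (Fin 3))) := by
    have h1 := hUm hwm
    rwa [hUnion, Measure.restrict_univ] at h1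
  set u : ℝ → EuclideanSpace ℝ (Fin 3) → EuclideanSpace ℝ (Fin 3) := fun t x => Ug (t, x) with hu
  -- transfer of the convergence, the slice bounds and the pairings
  have hut : ∀ n, Tendsto (fun k => ∫⁻ z in Q n, ‖U (φ k) z.1 z.2 - u z.1 z.2‖ₑ ^ 2) atTop (𝓝 0) := by
    intro n
    refine (hwt n).congr fun k => lintegral_congr_ae ?_
    filter_upwards [hU n] with z hz
    change ‖U (φ k) z.1 z.2 - uncurry (w n) z‖ₑ ^ 2 = ‖U (φ k) z.1 z.2 - Ug (z.1, z.2)‖ₑ ^ 2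
    rw [← hz]
  have hbox : ∀ n, ∀ᵐ t ∂(volume.restrict (I n)),
      ∀ᵐ x ∂(volume.restrict (ball (0 : EuclideanSpace ℝ (Fin 3)) (n + 1))),
        Ug (t, x) = uncurry (w n) (t, x) := by
    intro n
    have h1 := hU n
    have hprod : (volume.restrict (Q n)) = ((volume : Measure ℝ).restrict (I n)).prod
        ((volume : Measure (EuclideanSpace ℝ (Fin 3))).restrict
          (ball (0 : EuclideanSpace ℝ (Fin 3)) (n + 1))) := by
      rw [hQ, Measure.volume_eq_prod, Measure.prod_restrict]
    rw [hprod] at h1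
    exact Measure.ae_ae_of_ae_prod h1
  have hub : ∀ n : ℕ, ∀ᵐ t ∂(volume.restrict (I n)),
      ∫⁻ x in ball (0 : EuclideanSpace ℝ (Fin 3)) (n + 1), ‖u t x‖ₑ ^ 2 ≤ ENNReal.ofReal Cb := by
    intro n
    filter_upwards [hwb n, hbox n] with t ht ht'
    refine le_of_eq_of_le (lintegral_congr_ae ?_) ht
    filter_upwards [ht'] with x hx
    change ‖Ug (t, x)‖ₑ ^ 2 = ‖uncurry (w n) (t, x)‖ₑ ^ 2
    rw [hx]
  have huP : ∀ n (θ : EuclideanSpace ℝ (Fin 3) → ℝ), IsTestFunctionOn (Ω n) θ →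
      ∀ᵐ t ∂(volume.restrict (I n)),
        Tendsto (fun k => ∫ x in ball (0 : EuclideanSpace ℝ (Fin 3)) (n + 1), θ x • U (φ k) t x)
          atTop (𝓝 (∫ x in ball (0 : EuclideanSpace ℝ (Fin 3)) (n + 1), θ x • u t x)) := by
    intro n θ hθ
    filter_upwards [hwP n θ hθ, hbox n] with t ht ht'
    have e : ∫ x in ball (0 : EuclideanSpace ℝ (Fin 3)) (n + 1), θ x • u t x =
        ∫ x in ball (0 : EuclideanSpace ℝ (Fin 3)) (n + 1), θ x • w n t x := by
      refine integral_congr_ae ?_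
      filter_upwards [ht'] with x hx
      change θ x • Ug (t, x) = θ x • uncurry (w n) (t, x)
      rw [hx]
    rw [e]
    exact ht
  exact ⟨φ, u, hφ, fun k => ⟨hφ.monotone (Nat.le_succ k), hφ.id_le k⟩, hUmeas, hub, hut, huP⟩

end GalerkinLimit

end BradshawTsai2017

end Literature.Analysis.FluidPDE

end
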